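import Mathlib
import Summits.Ventures.LatticeQCDFlow.TrivializingMaps.FlowLightConeWindow
import Summits.Ventures.LatticeQCDFlow.TrivializingMaps.TruncatedGeneratorLipschitz
import Summits.Ventures.LatticeQCDFlow.TrivializingMaps.TruncatedGeneratorSupBound
import Summits.Ventures.LatticeQCDFlow.TrivializingMaps.GeneratorLocality
import Summits.Ventures.LatticeQCDFlow.TrivializingMaps.TruncatedWilsonFlowSampler
import HarnessLib

/-!
HONEST FRAMING: exact (Metropolis-corrected) sampling algorithms for lattice gauge theory; figures
of merit are autocorrelation/cost numbers at stated couplings and volumes; no continuum-physics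
claim.

# TruncatedFlowLightCone — THE VOLUME-UNIFORM LIGHT CONE OF LÜSCHER'S ORDER-`N` TRUNCATED
# WILSON-FLOW MAPS, UNCONDITIONAL (THEORY-1.md §26, FANOUT row 82; cell pub-lqcd, lean-2 GEN-5 assembly)

The samplers of record of the cell (S3/S4, `TruncatedWilsonFlowSampler.lean`) push Haar samples through a
flow map `Φ` of the generator `Z_t = -∂S̃^{[N]}_t`, `S̃^{[N]}_t = ∑_{k≤N} t^k S̃^{(k)}`, where `S̃^{(k)}` is ANY
smooth solution of Lüscher's recursion (4.12)–(4.13) for the action `β·S_W` on the periodic lattice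
`(ℤ/L)^d`, gauge group `SU(n)`.  This file composes four tree theorems into the statement the venture's
theory brief asks for ("locality of the flow-defined map … how the required network size must scale with
VOLUME"):

* THEOREM L in its flow-time-window form (`IsFlowMap.lightConeOn`, `FlowLightConeWindow.lean`);
* `K_Z` — the sup-Lipschitz modulus of `Z_t` on `SU(n)^E` with respect to the links of the plaquette ball
  `linkBall (2(N+1)) e`, a polynomial in `T, |β|` with THEOREM-A coefficients and NO dependence on `L`
  (theory-1 row 80b, `GradedSeries.norm_linkGrad_truncFlowAction_smul_gradedSk_sub_le_window`);
* `M_Z` — the sup bound of `Z_t` on `SU(n)^E` (theory-1 row 81,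
  `GradedSeries.norm_linkGrad_truncFlowAction_smul_gradedSk_le`), here put on the window `|t| ≤ T`
  (§1: the three window lemmas of theory-1's row-81 re-issue, which "ride with row 82");
* uniqueness of gradients of smooth Lüscher series (`IsLuscherSeries.linkDeriv_eq`): on `SU(n)^E` the
  generator of EVERY smooth solution for `β·S_W` is the generator of the `β`-scaled Casimir-graded series
  `β^{k+1} S̃^{(k)}` (§2), so `K_Z`, `M_Z` serve every sampler of record.

MAIN THEOREM (`truncatedFlow_lightCone`, §4).  Let `d, n ≠ 0, B, β, N, T ≥ 0` and put
`c := n·K_Z(T) + M_Z(T)` (`coneRate`, §3; volume-free).  For every `L`, every smooth solution `S̃^{(k)}`,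
every flow map `Φ` of `-∂S̃^{[N]}_t` (`IsFlowMap`), every level function `lvl : E → ℕ` that is 1-Lipschitz
for the read sets (`lvl e ≤ lvl e' + 1` for `e' ∈ linkBall (2(N+1)) e`) and all initial fields `V, V'`
agreeing at every link of level `≥ 1`:

  `‖Φ_t(V)_e - Φ_t(V')_e‖_F ≤ 2n · e^{ct} (ct)^{lvl e} / (lvl e)!`   for all `t ∈ [0, T]`, all links `e`.

COROLLARY (`truncatedFlow_lightCone_ball`, §4): if `V = V'` on the plaquette ball
`linkBall (2(N+1)·m) e₀` then `‖Φ_t(V)_{e₀} - Φ_t(V')_{e₀}‖_F ≤ 2n · e^{ct}(ct)^m/m!` on `[0, T]` — the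
influence of the links at `m` read-set hops decays like `(ct)^m/m! ≤ (e c t/m)^m`, with `c` depending on
`d, n, B, β, T, N` only: the time-`t` map of the order-`N` flow is quasi-local UNIFORMLY IN THE VOLUME
(network-size reading, THEORY-1 §26.3: a receptive radius `≈ 2(N+1)·max(e c t, log(1/ε))` links,
independent of `L`).  §4 also records the level function built from plaquette balls (`ballLevel`), the
non-vacuity of the statement (`exists_isFlowMap_lightCone`: the flow exists, tree
`exists_isFlowMap_truncFlowAction`) and the volume-uniformity BY QUANTIFIER ORDER
(`truncatedFlow_lightCone_uniform`: `∃ c ≥ 0, ∀ L, …` — suggested by theory-1's reference draft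
`FlowLightConeWilson.lean`, INBOX l.3222).

NOT claimed: any bound at flow times with `t|β|` beyond THEOREM A's radius being "good" (the statement
holds for every `T`, but `c(T)` grows polynomially in `T, |β|` of degree `N+1`); nothing about the exact
all-orders map outside the strong-coupling window; no cost / acceptance statement.

References: M. Lüscher, Commun. Math. Phys. 293 (2010) 899 [Luscher2010Trivializing], §3.1–§3.2 eqs.
(3.2), (3.6), §4.2 eq. (4.4), §4.5(b)(c); H. Raz, R. Sims, J. Stat. Phys. 137 (2009) 79 (arXiv:0902.0025),
Thm. 1 (the Lieb–Robinson mechanism); THEORY-1.md §26.1–§26.9.  Credits: §1 is theory-1's (row 81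
re-issue 627f930c, planner-pub-lqcd-theory1-g17-0), landed here by agreement (INBOX l.3190/l.3209).
-/

noncomputable section

open Finset

/-! ## §1. `M_Z` on a flow-time window (theory-1, row 81 re-issue) -/

namespace Summit.Ventures.LatticeQCDFlow.TrivializingMaps.GradedSeries

open Literature.MathematicalPhysics.QuantumFieldTheory
open Literature.MathematicalPhysics.QuantumFieldTheory.Luscher2010
open scoped Matrix Matrix.Norms.Frobenius ContDiff

variable {d L n : ℕ} [NeZero L] (B : SuBasis n)

omit [NeZero L] in
/-- Monotonicity of the polynomial bound in `|t|`: on a flow-time window `|t| ≤ T` the constant may be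
taken at `T`. [folklore] -/
theorem sum_pow_abs_le_sum_pow {t T : ℝ} (htT : |t| ≤ T) (N : ℕ) (c : ℕ → ℝ) (hc : ∀ k, 0 ≤ c k) :
    ∑ k ∈ Finset.range (N + 1), |t| ^ k * c k ≤ ∑ k ∈ Finset.range (N + 1), T ^ k * c k :=
  Finset.sum_le_sum fun k _ =>
    mul_le_mul_of_nonneg_right (pow_le_pow_left₀ (abs_nonneg t) htT k) (hc k)

/-- **`M_Z` on a flow-time window**: for `|t| ≤ T`,
`‖∂S̃^{[N]}_{β,t}(ιU)(e)‖_F ≤ (∑_{k≤N} T^k |β|^{k+1} N₀ θ₁^k) · ∑ₐ ‖T^a‖_F`. [ours] -/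
theorem norm_linkGrad_truncFlowAction_smul_gradedSk_le_of_abs_le (hn : n ≠ 0) (β : ℝ) {t T : ℝ}
    (htT : |t| ≤ T) (N : ℕ) (U : GaugeConfig d L (Matrix.specialUnitaryGroup (Fin n) ℂ)) (e : Edge d L) :
    ‖linkGrad B (truncFlowAction (fun k W => β ^ (k + 1) * gradedSk (d := d) (L := L) B k W) t N)
        (WilsonFlow.coeConfig U) e‖
      ≤ (∑ k ∈ Finset.range (N + 1), T ^ k * (|β| ^ (k + 1) * (N0 d n * theta1 d n B ^ k))) *
          ∑ a, ‖B.T a‖ := by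
  refine (norm_linkGrad_truncFlowAction_smul_gradedSk_le B hn β t N U e).trans ?_
  refine mul_le_mul_of_nonneg_right (sum_pow_abs_le_sum_pow htT N _ fun k => ?_)
    (Finset.sum_nonneg fun a _ => norm_nonneg _)
  have h0 : 0 ≤ N0 d n := N0_nonneg d n
  have h1 : 0 ≤ theta1 d n B := zero_le_one.trans (one_le_theta1 d n B)
  positivity

/-- The same on the window for the generator `Z_t = -∂S̃^{[N]}_{β,t}` itself. [ours] -/
theorem norm_neg_linkGrad_truncFlowAction_smul_gradedSk_le_of_abs_le (hn : n ≠ 0) (β : ℝ) {t T : ℝ}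
    (htT : |t| ≤ T) (N : ℕ) (U : GaugeConfig d L (Matrix.specialUnitaryGroup (Fin n) ℂ)) (e : Edge d L) :
    ‖-linkGrad B (truncFlowAction (fun k W => β ^ (k + 1) * gradedSk (d := d) (L := L) B k W) t N)
        (WilsonFlow.coeConfig U) e‖
      ≤ (∑ k ∈ Finset.range (N + 1), T ^ k * (|β| ^ (k + 1) * (N0 d n * theta1 d n B ^ k))) *
          ∑ a, ‖B.T a‖ := by
  rw [norm_neg]
  exact norm_linkGrad_truncFlowAction_smul_gradedSk_le_of_abs_le B hn β htT N U e

/-! ## §2. Every smooth solution has the generator of the `β`-scaled graded series on `SU(n)^E` -/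

/-- **Gradient transfer.** For every smooth solution `S̃^{(k)}` of Lüscher's recursion for `β·S_W`, the
order-`N` generator on the field manifold is that of the `β`-scaled Casimir-graded series:
`∂S̃^{[N]}_t(ιU)(e) = ∂S̃^{[N]}_{β,graded,t}(ιU)(e)` (uniqueness of gradients of smooth Lüscher series,
`IsLuscherSeries.linkDeriv_eq`, and homogeneity `isLuscherSeries_smul_gradedSk`; smoothness
`contDiff_smul_gradedSk` of `WilsonFlowActionSeries`). [ours] -/
theorem linkGrad_truncFlowAction_eq_smul_gradedSk (β : ℝ) {Sk : ℕ → AmbConfig d L n → ℝ} {c : ℕ → ℝ}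
    (hsm : ∀ k, ContDiff ℝ ∞ (Sk k)) (hser : IsLuscherSeries B (fun W => β * ambWilsonAction W) Sk c)
    (t : ℝ) (N : ℕ) (U : GaugeConfig d L (Matrix.specialUnitaryGroup (Fin n) ℂ)) (e : Edge d L) :
    linkGrad B (truncFlowAction Sk t N) (WilsonFlow.coeConfig U) e =
      linkGrad B (truncFlowAction (fun k W => β ^ (k + 1) * gradedSk (d := d) (L := L) B k W) t N)
        (WilsonFlow.coeConfig U) e := by
  simp only [linkGrad]
  refine Finset.sum_congr rfl fun a _ => ?_
  have h : linkDeriv e (B.T a) (truncFlowAction Sk t N) (WilsonFlow.coeConfig U) =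
      linkDeriv e (B.T a)
        (truncFlowAction (fun k W => β ^ (k + 1) * gradedSk (d := d) (L := L) B k W) t N)
        (WilsonFlow.coeConfig U) := by
    rw [linkDeriv_truncFlowAction hsm, linkDeriv_truncFlowAction (contDiff_smul_gradedSk B β)]
    refine Finset.sum_congr rfl fun k _ => ?_
    rw [(IsLuscherSeries.linkDeriv_eq hser (isLuscherSeries_smul_gradedSk B β) hsm
      (contDiff_smul_gradedSk B β) k).2 e a U]
  rw [h]

end Summit.Ventures.LatticeQCDFlow.TrivializingMaps.GradedSeries

/-! ## §3. The constants `K_Z(T)`, `M_Z(T)` and the cone rate `c(T) = n K_Z(T) + M_Z(T)` -/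

namespace Summit.Ventures.LatticeQCDFlow.TrivializingMaps

open Literature.MathematicalPhysics.QuantumFieldTheory
open Literature.MathematicalPhysics.QuantumFieldTheory.Luscher2010
open Literature.MathematicalPhysics.QuantumFieldTheory.WilsonFlow (coeConfig)
open GradedSeries
open scoped Matrix Matrix.Norms.Frobenius Nat ContDiff

variable {d L n : ℕ}

/-- `K_Z(T) = (∑_{k≤N} T^k |β|^{k+1} 4(k+1) n N₀ θ₁^k) · ∑ₐ ‖T^a‖_F` — the sup-Lipschitz modulus of the
order-`N` generator on the flow-time window `[0, T)` (theory-1 row 80b); depends on `d, n, B, β, T, N`,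
NOT on the lattice size. [ours] -/
def KZ (d n : ℕ) (B : SuBasis n) (β T : ℝ) (N : ℕ) : ℝ :=
  (∑ k ∈ Finset.range (N + 1), T ^ k * (|β| ^ (k + 1) *
      (4 * ((k : ℝ) + 1) * n * (N0 d n * theta1 d n B ^ k)))) * ∑ a, ‖B.T a‖

/-- `M_Z(T) = (∑_{k≤N} T^k |β|^{k+1} N₀ θ₁^k) · ∑ₐ ‖T^a‖_F` — the sup bound of the order-`N` generator on
the window (theory-1 row 81); volume-free. [ours] -/
def MZ (d n : ℕ) (B : SuBasis n) (β T : ℝ) (N : ℕ) : ℝ :=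
  (∑ k ∈ Finset.range (N + 1), T ^ k * (|β| ^ (k + 1) * (N0 d n * theta1 d n B ^ k))) * ∑ a, ‖B.T a‖

/-- The cone rate `c(T) = n K_Z(T) + M_Z(T)` of THEOREM L for the order-`N` truncated Wilson flow;
volume-free. [ours] -/
def coneRate (d n : ℕ) (B : SuBasis n) (β T : ℝ) (N : ℕ) : ℝ :=
  n * KZ d n B β T N + MZ d n B β T N

/-- `K_Z(T) ≥ 0` for `T ≥ 0`. [ours] -/
theorem KZ_nonneg (d n : ℕ) (B : SuBasis n) (β : ℝ) {T : ℝ} (hT : 0 ≤ T) (N : ℕ) :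
    0 ≤ KZ d n B β T N := by
  unfold KZ
  have h0 : 0 ≤ N0 d n := N0_nonneg d n
  have h1 : 0 ≤ theta1 d n B := zero_le_one.trans (one_le_theta1 d n B)
  refine mul_nonneg (Finset.sum_nonneg fun k _ => ?_) (Finset.sum_nonneg fun a _ => norm_nonneg _)
  positivity

/-- `M_Z(T) ≥ 0` for `T ≥ 0`. [ours] -/
theorem MZ_nonneg (d n : ℕ) (B : SuBasis n) (β : ℝ) {T : ℝ} (hT : 0 ≤ T) (N : ℕ) :
    0 ≤ MZ d n B β T N := by
  unfold MZ
  have h0 : 0 ≤ N0 d n := N0_nonneg d n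
  have h1 : 0 ≤ theta1 d n B := zero_le_one.trans (one_le_theta1 d n B)
  refine mul_nonneg (Finset.sum_nonneg fun k _ => ?_) (Finset.sum_nonneg fun a _ => norm_nonneg _)
  positivity

/-- `c(T) ≥ 0` for `T ≥ 0`. [ours] -/
theorem coneRate_nonneg (d n : ℕ) (B : SuBasis n) (β : ℝ) {T : ℝ} (hT : 0 ≤ T) (N : ℕ) :
    0 ≤ coneRate d n B β T N := by
  unfold coneRate
  have := KZ_nonneg d n B β hT N
  have := MZ_nonneg d n B β hT N
  positivity

/-! ## §4. The light cone of the order-`N` truncated Wilson-flow maps -/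

section LightCone

variable [NeZero L]

/-- **THE LIGHT CONE OF THE ORDER-`N` TRUNCATED WILSON FLOW, EVERY VOLUME.**  For `n ≠ 0`, `T ≥ 0`, every
smooth solution `S̃^{(k)}` of Lüscher's recursion for `β·S_W`, every flow map `Φ` of
`Z_t = -∂S̃^{[N]}_t` on `SU(n)^E`, every level function `lvl` with `lvl e ≤ lvl e' + 1` for
`e' ∈ linkBall (2(N+1)) e`, and all `V, V'` agreeing at the links of level `≥ 1`:
`‖Φ_t(V)_e - Φ_t(V')_e‖_F ≤ 2n · e^{ct} (ct)^{lvl e}/(lvl e)!` for `t ∈ [0, T]`, with the volume-free rate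
`c = coneRate d n B β T N`. [ours; cf. Luscher2010Trivializing §3.2, §4.5(b); Raz–Sims 2009 Thm. 1] -/
theorem truncatedFlow_lightCone (hn : n ≠ 0) (B : SuBasis n) (β : ℝ) (N : ℕ) {T : ℝ} (hT : 0 ≤ T)
    {Sk : ℕ → AmbConfig d L n → ℝ} {c : ℕ → ℝ} (hsm : ∀ k, ContDiff ℝ ∞ (Sk k))
    (hser : IsLuscherSeries B (fun W => β * ambWilsonAction W) Sk c)
    {Φ : ℝ → GaugeConfig d L (Matrix.specialUnitaryGroup (Fin n) ℂ) →
      GaugeConfig d L (Matrix.specialUnitaryGroup (Fin n) ℂ)}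
    (hΦ : IsFlowMap (fun t W => -linkGrad B (truncFlowAction Sk t N) W) Φ)
    (lvl : Edge d L → ℕ) (hlvl : ∀ e, ∀ e' ∈ linkBall (2 * (N + 1)) e, lvl e ≤ lvl e' + 1)
    (V V' : GaugeConfig d L (Matrix.specialUnitaryGroup (Fin n) ℂ))
    (hVV' : ∀ e, 1 ≤ lvl e → V e = V' e) :
    ∀ t ∈ Set.Icc 0 T, ∀ e, ‖coeConfig (Φ t V) e - coeConfig (Φ t V') e‖ ≤
      2 * n * Real.exp (coneRate d n B β T N * t) *
        (coneRate d n B β T N * t) ^ (lvl e) / ((lvl e)! : ℝ) := by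
  have hgen : ∀ (s : ℝ) (U : GaugeConfig d L (Matrix.specialUnitaryGroup (Fin n) ℂ)) (e : Edge d L),
      linkGrad B (truncFlowAction Sk s N) (coeConfig U) e =
        linkGrad B (truncFlowAction (fun k W => β ^ (k + 1) * gradedSk (d := d) (L := L) B k W) s N)
          (coeConfig U) e := fun s U e => linkGrad_truncFlowAction_eq_smul_gradedSk B β hsm hser s N U e
  have h := IsFlowMap.lightConeOn hΦ (fun e => linkBall (2 * (N + 1)) e) (fun e => self_mem_linkBall _ e)
    lvl hlvl (KZ_nonneg d n B β hT N) (MZ_nonneg d n B β hT N) T ?_ ?_ V V' hVV'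
  · simpa only [coneRate] using h
  · intro s hs U U' e M hM hUU'
    simp only [Pi.neg_apply]
    rw [hgen s U e, hgen s U' e]
    exact norm_neg_linkGrad_truncFlowAction_smul_gradedSk_sub_le_window B hn β T N s hs U U' e M hM hUU'
  · intro s hs U e
    simp only [Pi.neg_apply]
    rw [hgen s U e]
    have hsT : |s| ≤ T := by rw [abs_of_nonneg hs.1]; exact hs.2.le
    exact norm_neg_linkGrad_truncFlowAction_smul_gradedSk_le_of_abs_le B hn β hsT N U e

/-- **Uniform form outside the cone**: under the hypotheses of `truncatedFlow_lightCone`, for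
`t ∈ [0, T]` with `ct ≤ 1` every link of level `≥ m` moves by at most `2n · e^{ct}(ct)^m/m!`. [ours] -/
theorem truncatedFlow_lightCone_level_mono (hn : n ≠ 0) (B : SuBasis n) (β : ℝ) (N : ℕ) {T : ℝ}
    (hT : 0 ≤ T) {Sk : ℕ → AmbConfig d L n → ℝ} {c : ℕ → ℝ} (hsm : ∀ k, ContDiff ℝ ∞ (Sk k))
    (hser : IsLuscherSeries B (fun W => β * ambWilsonAction W) Sk c)
    {Φ : ℝ → GaugeConfig d L (Matrix.specialUnitaryGroup (Fin n) ℂ) →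
      GaugeConfig d L (Matrix.specialUnitaryGroup (Fin n) ℂ)}
    (hΦ : IsFlowMap (fun t W => -linkGrad B (truncFlowAction Sk t N) W) Φ)
    (lvl : Edge d L → ℕ) (hlvl : ∀ e, ∀ e' ∈ linkBall (2 * (N + 1)) e, lvl e ≤ lvl e' + 1)
    (V V' : GaugeConfig d L (Matrix.specialUnitaryGroup (Fin n) ℂ))
    (hVV' : ∀ e, 1 ≤ lvl e → V e = V' e) {t : ℝ} (ht : t ∈ Set.Icc 0 T)
    (hct : coneRate d n B β T N * t ≤ 1) (m : ℕ) (e : Edge d L) (hm : m ≤ lvl e) :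
    ‖coeConfig (Φ t V) e - coeConfig (Φ t V') e‖ ≤
      2 * n * Real.exp (coneRate d n B β T N * t) * (coneRate d n B β T N * t) ^ m / (m ! : ℝ) := by
  have hc0 : 0 ≤ coneRate d n B β T N * t := mul_nonneg (coneRate_nonneg d n B β hT N) ht.1
  refine (truncatedFlow_lightCone hn B β N hT hsm hser hΦ lvl hlvl V V' hVV' t ht e).trans ?_
  have hA : 0 ≤ 2 * (n : ℝ) * Real.exp (coneRate d n B β T N * t) := by positivity
  rw [mul_div_assoc, mul_div_assoc]
  refine mul_le_mul_of_nonneg_left ?_ hA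
  rw [div_le_div_iff₀ (by positivity) (by positivity)]
  calc (coneRate d n B β T N * t) ^ lvl e * (m ! : ℝ)
      ≤ (coneRate d n B β T N * t) ^ m * (m ! : ℝ) :=
        mul_le_mul_of_nonneg_right (pow_le_pow_of_le_one hc0 hct hm) (by positivity)
    _ ≤ (coneRate d n B β T N * t) ^ m * ((lvl e)! : ℝ) :=
        mul_le_mul_of_nonneg_left (by exact_mod_cast Nat.factorial_le hm) (by positivity)

open scoped Classical in
/-- **The level function of a plaquette ball.**  `ballLevel R m e₀ e` is the largest `j ≤ m` with
`linkBall (R j) e ⊆ linkBall (R m) e₀` (the number of whole read-set hops from `e` that stay inside the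
ball of `m` hops about `e₀`). [ours] -/
def ballLevel (R m : ℕ) (e₀ e : Edge d L) : ℕ :=
  Nat.findGreatest (fun j => linkBall (R * j) e ⊆ linkBall (R * m) e₀) m

omit [NeZero L] in
/-- The centre has level `m`. [ours] -/
theorem ballLevel_self (R m : ℕ) (e₀ : Edge d L) : ballLevel R m e₀ e₀ = m := by
  classical
  exact Nat.findGreatest_eq (P := fun j => linkBall (R * j) e₀ ⊆ linkBall (R * m) e₀) subset_rfl

omit [NeZero L] in
/-- A link of positive level lies in the ball. [ours] -/
theorem mem_linkBall_of_ballLevel_pos {R m : ℕ} {e₀ e : Edge d L} (h : 1 ≤ ballLevel R m e₀ e) :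
    e ∈ linkBall (R * m) e₀ := by
  classical
  have hne : ballLevel R m e₀ e ≠ 0 := by omega
  have hP : linkBall (R * ballLevel R m e₀ e) e ⊆ linkBall (R * m) e₀ :=
    Nat.findGreatest_of_ne_zero (P := fun j => linkBall (R * j) e ⊆ linkBall (R * m) e₀) (n := m) rfl hne
  exact hP (self_mem_linkBall _ e)

omit [NeZero L] in
/-- The ball level is 1-Lipschitz for the read-set graph of radius `R` (triangle inequality
`linkBall_add`). [ours] -/
theorem ballLevel_le_succ (R m : ℕ) (e₀ e : Edge d L) {e' : Edge d L} (he' : e' ∈ linkBall R e) :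
    ballLevel R m e₀ e ≤ ballLevel R m e₀ e' + 1 := by
  classical
  set j := ballLevel R m e₀ e with hj
  rcases Nat.eq_zero_or_pos j with h0 | hpos
  · omega
  · have hP : linkBall (R * j) e ⊆ linkBall (R * m) e₀ :=
      Nat.findGreatest_of_ne_zero (P := fun j => linkBall (R * j) e ⊆ linkBall (R * m) e₀) (n := m)
        hj.symm (by omega)
    have hjm : j ≤ m :=
      hj ▸ Nat.findGreatest_le (P := fun j => linkBall (R * j) e ⊆ linkBall (R * m) e₀) m
    have hP' : linkBall (R * (j - 1)) e' ⊆ linkBall (R * m) e₀ := by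
      intro e'' he''
      have h1 : e'' ∈ linkBall (R + R * (j - 1)) e := linkBall_add he' he''
      refine hP (linkBall_mono (le_of_eq ?_) e h1)
      have : R + R * (j - 1) = R * j := by
        conv_rhs => rw [← Nat.sub_add_cancel hpos]
        ring
      exact this
    have hle : j - 1 ≤ ballLevel R m e₀ e' :=
      Nat.le_findGreatest (P := fun j => linkBall (R * j) e' ⊆ linkBall (R * m) e₀) (by omega) hP'
    omega

/-- **COROLLARY — influence of far links on the order-`N` flow map, every volume.**  For `n ≠ 0`,
`T ≥ 0`, every smooth solution for `β·S_W`, every flow map `Φ` of `-∂S̃^{[N]}_t` and all `V, V'` that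
AGREE ON THE PLAQUETTE BALL `linkBall (2(N+1)·m) e₀`:
`‖Φ_t(V)_{e₀} - Φ_t(V')_{e₀}‖_F ≤ 2n · e^{ct}(ct)^m/m!` for all `t ∈ [0, T]`, `c = coneRate d n B β T N`
independent of `L` — the flow-defined map at `e₀` is determined to precision `2n(e c t/m)^m e^{ct}` by the
links within `m` read-set hops. [ours; cf. Luscher2010Trivializing §3.2, §4.5(b)] -/
theorem truncatedFlow_lightCone_ball (hn : n ≠ 0) (B : SuBasis n) (β : ℝ) (N : ℕ) {T : ℝ} (hT : 0 ≤ T)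
    {Sk : ℕ → AmbConfig d L n → ℝ} {c : ℕ → ℝ} (hsm : ∀ k, ContDiff ℝ ∞ (Sk k))
    (hser : IsLuscherSeries B (fun W => β * ambWilsonAction W) Sk c)
    {Φ : ℝ → GaugeConfig d L (Matrix.specialUnitaryGroup (Fin n) ℂ) →
      GaugeConfig d L (Matrix.specialUnitaryGroup (Fin n) ℂ)}
    (hΦ : IsFlowMap (fun t W => -linkGrad B (truncFlowAction Sk t N) W) Φ)
    (e₀ : Edge d L) (m : ℕ) (V V' : GaugeConfig d L (Matrix.specialUnitaryGroup (Fin n) ℂ))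
    (hVV' : ∀ e ∈ linkBall (2 * (N + 1) * m) e₀, V e = V' e) :
    ∀ t ∈ Set.Icc 0 T, ‖coeConfig (Φ t V) e₀ - coeConfig (Φ t V') e₀‖ ≤
      2 * n * Real.exp (coneRate d n B β T N * t) * (coneRate d n B β T N * t) ^ m / (m ! : ℝ) := by
  intro t ht
  have h := truncatedFlow_lightCone hn B β N hT hsm hser hΦ (ballLevel (2 * (N + 1)) m e₀)
    (fun e e' he' => ballLevel_le_succ (2 * (N + 1)) m e₀ e he') V V'
    (fun e he => hVV' e (mem_linkBall_of_ballLevel_pos he)) t ht e₀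
  rwa [ballLevel_self] at h

/-- **Non-vacuity: the flow exists and has the light cone.**  For `n ≠ 0`, `T ≥ 0` and every smooth
solution for `β·S_W` there IS a (jointly continuous) flow map `Φ` of `-∂S̃^{[N]}_t` (Lüscher §3.1, tree
`exists_isFlowMap_truncFlowAction`), and it satisfies the ball light cone. [ours] -/
theorem exists_isFlowMap_lightCone (hn : n ≠ 0) (B : SuBasis n) (β : ℝ) (N : ℕ) {T : ℝ} (hT : 0 ≤ T)
    {Sk : ℕ → AmbConfig d L n → ℝ} {c : ℕ → ℝ} (hsm : ∀ k, ContDiff ℝ ∞ (Sk k))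
    (hser : IsLuscherSeries B (fun W => β * ambWilsonAction W) Sk c) :
    ∃ Φ : ℝ → GaugeConfig d L (Matrix.specialUnitaryGroup (Fin n) ℂ) →
        GaugeConfig d L (Matrix.specialUnitaryGroup (Fin n) ℂ),
      IsFlowMap (fun t W => -linkGrad B (truncFlowAction Sk t N) W) Φ ∧
      Continuous (fun p : ℝ × GaugeConfig d L (Matrix.specialUnitaryGroup (Fin n) ℂ) => Φ p.1 p.2) ∧
      ∀ (e₀ : Edge d L) (m : ℕ) (V V' : GaugeConfig d L (Matrix.specialUnitaryGroup (Fin n) ℂ)),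
        (∀ e ∈ linkBall (2 * (N + 1) * m) e₀, V e = V' e) →
        ∀ t ∈ Set.Icc 0 T, ‖coeConfig (Φ t V) e₀ - coeConfig (Φ t V') e₀‖ ≤
          2 * n * Real.exp (coneRate d n B β T N * t) * (coneRate d n B β T N * t) ^ m / (m ! : ℝ) := by
  obtain ⟨Φ, hΦ, hcont, -, -⟩ := exists_isFlowMap_truncFlowAction B hsm N
  exact ⟨Φ, hΦ, hcont, fun e₀ m V V' hVV' =>
    truncatedFlow_lightCone_ball hn B β N hT hsm hser hΦ e₀ m V V' hVV'⟩

end LightCone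

/-- **VOLUME-UNIFORMITY BY QUANTIFIER ORDER** (the one-line answer to the brief's "how must the
required network size scale with VOLUME"): for `n ≠ 0`, `T ≥ 0` and fixed `d, B, β, N` there is ONE rate
`c ≥ 0` such that FOR EVERY LATTICE SIZE `L`, every smooth solution for `β·S_W`, every flow map `Φ` of
`-∂S̃^{[N]}_t` and all `V, V'` agreeing on `linkBall (2(N+1)·m) e₀`:
`‖Φ_t(V)_{e₀} - Φ_t(V')_{e₀}‖_F ≤ 2n · e^{ct}(ct)^m/m!` on `[0, T]` (`c = coneRate d n B β T N`).
[ours; cf. Luscher2010Trivializing §3.2, §4.5(b)] -/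
theorem truncatedFlow_lightCone_uniform (d : ℕ) {n : ℕ} (hn : n ≠ 0) (B : SuBasis n) (β : ℝ) (N : ℕ)
    {T : ℝ} (hT : 0 ≤ T) :
    ∃ c : ℝ, 0 ≤ c ∧ ∀ (L : ℕ) [NeZero L] (Sk : ℕ → AmbConfig d L n → ℝ) (cs : ℕ → ℝ),
      (∀ k, ContDiff ℝ ∞ (Sk k)) → IsLuscherSeries B (fun W => β * ambWilsonAction W) Sk cs →
      ∀ (Φ : ℝ → GaugeConfig d L (Matrix.specialUnitaryGroup (Fin n) ℂ) →
          GaugeConfig d L (Matrix.specialUnitaryGroup (Fin n) ℂ)),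
        IsFlowMap (fun t W => -linkGrad B (truncFlowAction Sk t N) W) Φ →
      ∀ (e₀ : Edge d L) (m : ℕ) (V V' : GaugeConfig d L (Matrix.specialUnitaryGroup (Fin n) ℂ)),
        (∀ e ∈ linkBall (2 * (N + 1) * m) e₀, V e = V' e) →
        ∀ t ∈ Set.Icc 0 T, ‖coeConfig (Φ t V) e₀ - coeConfig (Φ t V') e₀‖ ≤
          2 * n * Real.exp (c * t) * (c * t) ^ m / (m ! : ℝ) :=
  ⟨coneRate d n B β T N, coneRate_nonneg d n B β hT N,
    fun _L _ _Sk _cs hsm hser _Φ hΦ e₀ m V V' hVV' =>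
      truncatedFlow_lightCone_ball hn B β N hT hsm hser hΦ e₀ m V V' hVV'⟩

end Summit.Ventures.LatticeQCDFlow.TrivializingMaps

end
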